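import Summits.MatrixMultiplication.MatrixMultiplication.Theorems.AbelianSTPPCensusTC2StatDefs

/-!
# T_C static certificate, range `2881 … 3003` (t*-indexed linear checker with the k-member tree at `τ = 12/5`): kernel evaluation, the shape checks (one-member cover, else the k-member tree), volumes `1601 … 1710`, all orders `2881 … 3003`

Cell mm-stpp (rung F-M1), tier T_C = «beat `2.4`»; checker in `AbelianSTPPCensusTC2StatDefs.lean`, table and bucket lists in `AbelianSTPPCensusTC2StatData.lean`
(pattern: theory g12's `AbelianSTPPCensusTAStatDDom*/DCk*.lean`).  `decide` with kernel reduction (standard axioms; no `native_decide`), `Elab.async false`;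
consumed by `TC2Stat.checkV_sound` / `TC2Stat.domV_sound` / `TC2Stat.m2V_sound` in the leaf `AbelianSTPPCensusLeafTC3003Closed.lean`.
WHAT THIS IS NOT: arithmetic on shape lists only; no statement about STPP families or `ω`.
-/

set_option linter.dupNamespace false
set_option autoImplicit false
set_option Elab.async false

namespace Summit.MatrixMultiplication.MatrixMultiplication.Theorems.TC2Stat

set_option maxHeartbeats 0 in
/-- Check chunk: every sorted candidate shape of the volumes `1601 … 1710` passes `checkShape` on the full order range (cost units 122939: (shape, bucket) cells and tree nodes). [original] -/
theorem ck1601 : TC2Stat.checkV 2881 3003 110 1601 = true := by decide +kernel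

end Summit.MatrixMultiplication.MatrixMultiplication.Theorems.TC2Stat
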